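import Summits.HodgeConjecture.HodgeConjecture.Theorems.K2E4ArchGPrimeLemmas               -- ★ p855296 (this seat): update ∕ insert laws + Radon (brings ★ Defs)
import Summits.HodgeConjecture.HodgeConjecture.Theorems.K2E4ArchGStateStep                 -- ★ p855079 (this seat) G3-step `tendsto_deriv_gState_step` (brings ★ G3-calc `two_sin_smul_eq_ofReal_mul`)
import Summits.HodgeConjecture.HodgeConjecture.Theorems.K2E4ArchPartnerWallJumpOfClause    -- ★ p855183 (this seat) G1c `…_noncompact_orbitMeasure_of_clause`
import Summits.HodgeConjecture.HodgeConjecture.Theorems.K2E4ArchWallDeltaFactor            -- ★ p854926 (K2E4-p13) G2 `exists_wallDeltaFactor`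
import Literature.NumberTheory.Rogawski1990.ArchLimitFormulaNoncompactWallLinksOfTransport -- ★ `archLimitFormulaNoncompactWall_clause_of_isHaarMeasure` (the (J-nc) constant is Haar-independent)
import Literature.NumberTheory.Automorphic.ArchEndoscopicStableSumTorus                    -- ★ `archCongrOfEq_quasiSplitFrameTwo_symm_archDiagTorus` (assembler `H`-point = Cayley point)
import HarnessLib

/-!
# The `G′`-package, (step): the ONE-STEP LAW of the κ-weighted `G′`-state along the central curve at an unprocessed place (Rogawski 1990 Prop. 8.2.1 (a) pp. 118–119, §8.2 pp. 122–124, §14.5 p. 238)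

Track B ∕ K2-LIT, crux h413 = `stmt-HodgeConjecture-24833`; prover seat `hodgecm-mathlib-K2E4-p11` (g0), V2 «G′ PACKAGE» for the assembler K2E4-p09 (`--supports … --as helper`).
**`gState_step`** — the field `step` of ★ `K2E4ExplicitArchSingularTransferDefs.GPrimeData` for the family `gState` of ★ `K2E4ArchGPrimeDefs`: for `w ∉ S` and `u` regular off
`S ∪ {w}`, `∂_ψ[(2 sin ψ) • B(S, u[w ↦ (σe₁ e^{iψ}, σe₁ e^{−iψ})])] ⟶ B(S ∪ {w}, u)` along `𝓝[>] 0`.  Assembly: ★ G2 `exists_wallDeltaFactor` (the transfer factor along the step datum is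
`K_ρ · σ(ψ)`, `σ` even `C¹` — read at the assembler's `H_∞`-point via ★ `archCongrOfEq_quasiSplitFrameTwo_symm_archDiagTorus`), ★ F1∕F2 (`stateMeasure_update_curve`,
`stateMeasure_insert`), the `(−1)`-pin `hpin` moved to the transported Haar measure `ν_w.map e_{τ⁻¹}⁻¹` by ★ `archLimitFormulaNoncompactWall_clause_of_isHaarMeasure` and threaded
through ★ G1c into ★ G3-step `tendsto_deriv_gState_step` (weights `a_ρ = χ·N⁻¹·K_ρ·∏_{v∈S} wallCoef_v(ρ_v)`, limits `ℓ_ρ = wallCoef_w(ρ_w)·∫Θ d⊗(state[w ↦ wallMeasure_w(ρ_w)])`),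
and ★ `two_sin_smul_eq_ofReal_mul` for the `•` observable.
HONEST LABEL: HC_CM is proved only modulo the 7 printed citations (2 remaining named inputs: hLiu418 = `stmt-HodgeConjecture-24832`, h413 = `stmt-HodgeConjecture-24833`) until rung 0
closes; assembly of ★ bricks, pays nothing by itself.

## References
* [Rogawski1990] J. D. Rogawski, *Automorphic Representations of Unitary Groups in Three Variables*, Ann. of Math. Stud. 123 (1990), Prop. 8.2.1 (a) pp. 118–119; §8.2 pp. 122–124;
  §14.5 Lemma 14.5.2 (b) pp. 238–239; §4.3 (4.3.1) p. 43.
* [Varadarajan1989] V. S. Varadarajan, *An Introduction to Harmonic Analysis on Semisimple Lie Groups* (1989), §6.4 Thm 22.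
* [DeitmarEchterhoff2014] A. Deitmar, S. Echterhoff, *Principles of Harmonic Analysis*, 2nd ed. (2014), Lemma 9.3.3, Thm. 1.5.3.
-/

set_option autoImplicit false
set_option linter.dupNamespace false  -- the cell's namespace convention `Summit.HodgeConjecture.HodgeConjecture.Cruxes.H413.<File>` repeats the summit = problem name

noncomputable section

open MeasureTheory Measure Filter Topology NumberField NumberField.InfinitePlace NumberField.mixedEmbedding Equiv Function Set
open Literature.MeasureTheory.Group Literature.NumberTheory.Automorphic Literature.NumberTheory.Automorphic.UnitaryGroup
open Literature.LinearAlgebra.Matrix Literature.NumberTheory.Rogawski1990 Literature.NumberTheory.GaloisRepresentations IsDedekindDomain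
open Summit.HodgeConjecture.HodgeConjecture.Cruxes.H413.K2E4ArchGPrimeDefs Summit.HodgeConjecture.HodgeConjecture.Cruxes.H413.K2E4ArchGPrimeLemmas
open Summit.HodgeConjecture.HodgeConjecture.Cruxes.H413
open scoped Matrix MatrixGroups Matrix.Norms.Operator ContDiff ENNReal Classical

namespace Summit.HodgeConjecture.HodgeConjecture.Cruxes.H413.K2E4ArchGPrimeStep

variable (L : Type) [Field L] [NumberField L] [IsCMField L] (α : Fin 3 → L) [MeasurableSpace (GL (Fin 3) ℂ)] [BorelSpace (GL (Fin 3) ℂ)]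
  [MeasurableSpace (arch (↥(maximalRealSubfield L)) L (IsCMField.complexConj L) 3 (Matrix.diagonal α))]
  [BorelSpace (arch (↥(maximalRealSubfield L)) L (IsCMField.complexConj L) 3 (Matrix.diagonal α))]

/-- **(step) — THE ONE-STEP LAW OF THE `G′`-STATE** (see the module docstring): for `w ∉ S` and `u` regular off `S ∪ {w}`,
`Tendsto (fun ψ => deriv (fun ψ => (2 * Real.sin ψ) • gState … S (u[w ↦ (σe₁ e^{iψ}, σe₁ e^{−iψ})])) ψ) (𝓝[>] 0) (𝓝 (gState … (insert w S) u))` — the field `step` of `GPrimeData` verbatim.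
[cite: Rogawski1990, Prop. 8.2.1 (a) p. 119; §8.2 p. 124; §14.5 p. 238] [cite: Varadarajan1989, §6.4 Thm 22] [cite: DeitmarEchterhoff2014, Lemma 9.3.3] -/
theorem gState_step
    (hα : ∀ i, α i ≠ 0) (hherm : ∀ i, (IsCMField.complexConj L (α i) : L) = α i)
    (νw : ∀ v : {w : InfinitePlace L // IsComplex w}, Measure (archLocal L 3 (Matrix.diagonal α) v)) (hνw : ∀ v, (νw v).IsHaarMeasure ∧ (νw v).IsMulRightInvariant)
    (e₁ e₂ : L) (h₁ : (IsCMField.complexConj L e₁ : L) * e₁ = 1) (h₂ : (IsCMField.complexConj L e₂ : L) * e₂ = 1) (hne : e₁ ≠ e₂)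
    [∀ (w : {w : InfinitePlace L // IsComplex w}) (τ : Perm (Fin 3)), MeasurableSpace (archLocal L 3 (Matrix.diagonal (α ∘ ⇑τ)) w ⧸ Subgroup.centralizer
      ({(⟨circleDiagonal 3 (wallPoint L e₁ e₂ h₁ h₂ w), circleDiagonal_mem_archLocal_diagonal L 3 (α ∘ ⇑τ) w (wallPoint L e₁ e₂ h₁ h₂ w)⟩ : archLocal L 3 (Matrix.diagonal (α ∘ ⇑τ)) w)} :
        Set (archLocal L 3 (Matrix.diagonal (α ∘ ⇑τ)) w)))]
    [∀ (w : {w : InfinitePlace L // IsComplex w}) (τ : Perm (Fin 3)), BorelSpace (archLocal L 3 (Matrix.diagonal (α ∘ ⇑τ)) w ⧸ Subgroup.centralizer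
      ({(⟨circleDiagonal 3 (wallPoint L e₁ e₂ h₁ h₂ w), circleDiagonal_mem_archLocal_diagonal L 3 (α ∘ ⇑τ) w (wallPoint L e₁ e₂ h₁ h₂ w)⟩ : archLocal L 3 (Matrix.diagonal (α ∘ ⇑τ)) w)} :
        Set (archLocal L 3 (Matrix.diagonal (α ∘ ⇑τ)) w)))]
    (νH : ∀ (w : {w : InfinitePlace L // IsComplex w}) (τ : Perm (Fin 3)), Measure (Subgroup.centralizer
      ({(⟨circleDiagonal 3 (wallPoint L e₁ e₂ h₁ h₂ w), circleDiagonal_mem_archLocal_diagonal L 3 (α ∘ ⇑τ) w (wallPoint L e₁ e₂ h₁ h₂ w)⟩ : archLocal L 3 (Matrix.diagonal (α ∘ ⇑τ)) w)} :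
        Set (archLocal L 3 (Matrix.diagonal (α ∘ ⇑τ)) w))))
    (hνH : ∀ w τ, (νH w τ).IsHaarMeasure ∧ (νH w τ).IsInvInvariant)
    (hpin : ∀ (w : {w : InfinitePlace L // IsComplex w}) (τ : Perm (Fin 3)), (w.1.embedding (α (τ 0))).re * (w.1.embedding (α (τ 2))).re < 0 →
        haveI : LocallyCompactSpace (archLocal L 3 (Matrix.diagonal (α ∘ ⇑τ)) w) := locallyCompactSpace_archLocal L 3 (Matrix.diagonal (α ∘ ⇑τ)) w
        haveI : SecondCountableTopology (archLocal L 3 (Matrix.diagonal (α ∘ ⇑τ)) w) := secondCountableTopology_archLocal L 3 (Matrix.diagonal (α ∘ ⇑τ)) w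
        haveI : (νH w τ).IsHaarMeasure := (hνH w τ).1
        haveI : (νH w τ).IsInvInvariant := (hνH w τ).2
        ∃ (ν : Measure (archLocal L 3 (Matrix.diagonal (α ∘ ⇑τ)) w)) (_ : ν.IsHaarMeasure) (_ : ν.IsMulRightInvariant),
          ∀ (Θ : Matrix (Fin 3) (Fin 3) ℂ → ℂ), ContDiff ℝ (⊤ : ℕ∞) Θ →
            HasCompactSupport (fun k : archLocal L 3 (Matrix.diagonal (α ∘ ⇑τ)) w => Θ ((k : GL (Fin 3) ℂ) : Matrix (Fin 3) (Fin 3) ℂ)) →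
            ∀ (z₀ : Fin 3 → Circle) (h02' : z₀ 0 = z₀ 2) (h01' : z₀ 0 ≠ z₀ 1),
              Tendsto (fun ψ : ℝ => deriv (fun ψ : ℝ => (2 * Real.sin ψ : ℂ) *
                  ∫ g, Θ (((g * ⟨circleDiagonal 3 (fun i => z₀ i * Circle.exp (![(1 : ℝ), 0, -1] i * ψ)),
                    circleDiagonal_mem_archLocal_diagonal L 3 (α ∘ ⇑τ) w _⟩ * g⁻¹ : archLocal L 3 (Matrix.diagonal (α ∘ ⇑τ)) w) : GL (Fin 3) ℂ) : Matrix (Fin 3) (Fin 3) ℂ) ∂(ν)) ψ)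
                (𝓝[≠] 0)
                (𝓝 ((-1 : ℂ) * ∫ y, descConj (⟨circleDiagonal 3 z₀, circleDiagonal_mem_archLocal_diagonal L 3 (α ∘ ⇑τ) w z₀⟩ : archLocal L 3 (Matrix.diagonal (α ∘ ⇑τ)) w)
                  (Subgroup.centralizer ({(⟨circleDiagonal 3 (wallPoint L e₁ e₂ h₁ h₂ w), circleDiagonal_mem_archLocal_diagonal L 3 (α ∘ ⇑τ) w (wallPoint L e₁ e₂ h₁ h₂ w)⟩ : archLocal L 3 (Matrix.diagonal (α ∘ ⇑τ)) w)} : Set (archLocal L 3 (Matrix.diagonal (α ∘ ⇑τ)) w)))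
                  (forall_mem_centralizer_circleDiagonal_comm_of_wall L (α ∘ ⇑τ) w (wallPoint_zero_eq_two L e₁ e₂ h₁ h₂ w) (wallPoint_zero_ne_one L e₁ e₂ h₁ h₂ hne w) h02' h01')
                  (fun k : archLocal L 3 (Matrix.diagonal (α ∘ ⇑τ)) w => Θ ((k : GL (Fin 3) ℂ) : Matrix (Fin 3) (Fin 3) ℂ)) y
                  ∂(quotientMeasure _ (νH w τ) (isClosed_coe_centralizer_singleton _) (ν)))))
    (T' : ArchTransferFactor L (Matrix.diagonal α)) (μω : HeckeCharacter L)
    (hμω : ∀ x : ideleGroup ↥(maximalRealSubfield L), μω (AdeleRing.ideleBaseChange (↥(maximalRealSubfield L)) L x) = quadraticHeckeCharCM L x)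
    (cT : ℂ) (hcT : cT ≠ 0) (hT : ∀ a b, T'.Δ a b = cT * archExplicitDelta L (Matrix.diagonal α) a μω b)
    (χ : ℝ≥0∞) (Θ : Matrix (Fin 3) (Fin 3) (mixedSpace L) → ℂ) (hΘ : ContDiff ℝ (⊤ : ℕ∞) Θ)
    (hΘc : HasCompactSupport (fun g : arch (↥(maximalRealSubfield L)) L (IsCMField.complexConj L) 3 (Matrix.diagonal α) => Θ ((g : GL (Fin 3) (mixedSpace L)) : Matrix (Fin 3) (Fin 3) (mixedSpace L))))
    (S : Finset {w : InfinitePlace L // IsComplex w}) (w : {w : InfinitePlace L // IsComplex w}) (hw : w ∉ S)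
    (u : {w : InfinitePlace L // IsComplex w} → Fin 2 → Circle)
    (hu : ∀ v, v ∉ S → v ≠ w → u v 0 ≠ u v 1 ∧ u v 0 ≠ embCircle L e₂ h₂ v ∧ u v 1 ≠ embCircle L e₂ h₂ v) :
    Tendsto (fun ψ : ℝ => deriv (fun ψ : ℝ => (2 * Real.sin ψ) •
        gState L α νw hνw e₁ e₂ h₁ h₂ hne νH hνH T' χ Θ S (Function.update u w ![embCircle L e₁ h₁ w * Circle.exp ψ, embCircle L e₁ h₁ w * Circle.exp (-ψ)])) ψ)
      (𝓝[>] 0) (𝓝 (gState L α νw hνw e₁ e₂ h₁ h₂ hne νH hνH T' χ Θ (insert w S) u)) := by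
  classical
  -- instances at every place and on every relabelled group
  haveI iLCv : ∀ v : {w : InfinitePlace L // IsComplex w}, LocallyCompactSpace (archLocal L 3 (Matrix.diagonal α) v) := fun v => locallyCompactSpace_archLocal L 3 (Matrix.diagonal α) v
  haveI iSCv : ∀ v : {w : InfinitePlace L // IsComplex w}, SecondCountableTopology (archLocal L 3 (Matrix.diagonal α) v) := fun v => secondCountableTopology_archLocal L 3 (Matrix.diagonal α) v
  haveI iLC : ∀ σ' : Perm (Fin 3), LocallyCompactSpace (archLocal L 3 (Matrix.diagonal (α ∘ ⇑σ')) w) := fun σ' => locallyCompactSpace_archLocal L 3 (Matrix.diagonal (α ∘ ⇑σ')) w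
  haveI iSC : ∀ σ' : Perm (Fin 3), SecondCountableTopology (archLocal L 3 (Matrix.diagonal (α ∘ ⇑σ')) w) := fun σ' => secondCountableTopology_archLocal L 3 (Matrix.diagonal (α ∘ ⇑σ')) w
  haveI iνh : ∀ v : {w : InfinitePlace L // IsComplex w}, (νw v).IsHaarMeasure := fun v => (hνw v).1
  haveI iνr : ∀ v : {w : InfinitePlace L // IsComplex w}, (νw v).IsMulRightInvariant := fun v => (hνw v).2
  haveI iHh : ∀ τ : Perm (Fin 3), (νH w τ).IsHaarMeasure := fun τ => (hνH w τ).1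
  haveI iHi : ∀ τ : Perm (Fin 3), (νH w τ).IsInvInvariant := fun τ => (hνH w τ).2
  haveI iTh : ∀ σ' : Perm (Fin 3), ((νw w).map (ContinuousMulEquiv.restrictSubgroup (GLn.conjEquiv (Matrix.GeneralLinearGroup.mkOfDetNeZero _ (det_monomial_one_ne_zero 3 σ')))
      (archLocal L 3 (Matrix.diagonal (α ∘ ⇑σ')) w) (archLocal L 3 (Matrix.diagonal α) w)
      (mem_archLocal_comp_perm_iff_conj_mem L 3 α w σ')).symm).IsHaarMeasure := fun _ => ContinuousMulEquiv.isHaarMeasure_map (νw w) _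
  haveI iTr : ∀ σ' : Perm (Fin 3), ((νw w).map (ContinuousMulEquiv.restrictSubgroup (GLn.conjEquiv (Matrix.GeneralLinearGroup.mkOfDetNeZero _ (det_monomial_one_ne_zero 3 σ')))
      (archLocal L 3 (Matrix.diagonal (α ∘ ⇑σ')) w) (archLocal L 3 (Matrix.diagonal α) w)
      (mem_archLocal_comp_perm_iff_conj_mem L 3 α w σ')).symm).IsMulRightInvariant := fun σ' => isMulRightInvariant_map_relabel_symm L 3 α w σ' (νw w)
  have h02 := wallPoint_zero_eq_two L e₁ e₂ h₁ h₂ w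
  have h01 := wallPoint_zero_ne_one L e₁ e₂ h₁ h₂ hne w
  have h12 : ∀ v : {w : InfinitePlace L // IsComplex w}, embCircle L e₁ h₁ v ≠ embCircle L e₂ h₂ v := fun v => wallPoint_zero_ne_one L e₁ e₂ h₁ h₂ hne v
  -- ★ G2: the flat factor `σ` and the signs `K` along the step datum (2-block data `twoBlock S u`, centre `σe₁`, frozen `σe₂`)
  have hũ : ∀ v : {w : InfinitePlace L // IsComplex w}, v ≠ w → twoBlock L e₁ h₁ S u v 0 ≠ embCircle L e₂ h₂ v ∧ twoBlock L e₁ h₁ S u v 1 ≠ embCircle L e₂ h₂ v := by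
    intro v hvw
    by_cases hvS : v ∈ S
    · simp only [twoBlock, if_pos hvS, Matrix.cons_val_zero, Matrix.cons_val_one]
      exact ⟨h12 v, h12 v⟩
    · simp only [twoBlock, if_neg hvS]
      exact ⟨(hu v hvS hvw).2.1, (hu v hvS hvw).2.2⟩
  obtain ⟨K, σ, hσ, heven, -, -, hKσ⟩ := K2E4ArchWallDeltaFactor.exists_wallDeltaFactor L α _ rfl μω hμω T' cT hT w (fun v => embCircle L e₁ h₁ v) (fun v => embCircle L e₂ h₂ v)
    (twoBlock L e₁ h₁ S u) hα hherm hcT (h12 w) hũ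
  -- the assembler's `H_∞`-point is the Cayley point
  have hpt : ∀ U : {w : InfinitePlace L // IsComplex w} → Fin 2 → Circle,
      ((unitaryGroupOfFormCongrOfEq (UnitaryGroup.conjMixed (↥(maximalRealSubfield L)) L (IsCMField.complexConj L))
              (Matrix.GeneralLinearGroup.map (mixedEmbedding L) (Matrix.GeneralLinearGroup.mkOfDetNeZero !![(1 : L), 1; 1, -1] (UnitaryGroup.det_quasiSplitFrameTwo_ne_zero L)))
              (UnitaryGroup.archFormOf L 2 (Matrix.diagonal ![(2 : L)⁻¹, -(2 : L)⁻¹])) (UnitaryGroup.archFormOf L 2 (Matrix.of fun i j : Fin 2 => if i.val + j.val + 1 = 2 then (1 : L) else 0))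
              (UnitaryGroup.formCongr_map_mixedEmbedding_archFormOf_eq L (UnitaryGroup.formCongr_quasiSplitFrameTwo_diagonal L))).symm
              (UnitaryGroup.archDiagTorus L 2 ![(2 : L)⁻¹, -(2 : L)⁻¹] U)) =
      ((archPiEquivCM 2 L (Matrix.of fun i j : Fin 2 => if i.val + j.val + 1 = 2 then (1 : L) else 0)).symm fun w' =>
        ⟨Matrix.GeneralLinearGroup.mkOfDetNeZero !![(1 : ℂ), 1; 1, -1] det_cayleyTwo_ne_zero * circleDiagonal 2 ![U w' 0, U w' 1] *
            (Matrix.GeneralLinearGroup.mkOfDetNeZero !![(1 : ℂ), 1; 1, -1] det_cayleyTwo_ne_zero)⁻¹,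
          cayley_conj_circleDiagonal_mem_archLocal L w' _⟩) := by
    intro U
    rw [archCongrOfEq_quasiSplitFrameTwo_symm_archDiagTorus]
    congr 1
  -- ★ G2 read at the package's `H_∞`-point and datum
  have hΔ : ∀ (ψ : ℝ) (ρ : {w : InfinitePlace L // IsComplex w} → Perm (Fin 3)),
      T'.Δ (((unitaryGroupOfFormCongrOfEq (UnitaryGroup.conjMixed (↥(maximalRealSubfield L)) L (IsCMField.complexConj L))
              (Matrix.GeneralLinearGroup.map (mixedEmbedding L) (Matrix.GeneralLinearGroup.mkOfDetNeZero !![(1 : L), 1; 1, -1] (UnitaryGroup.det_quasiSplitFrameTwo_ne_zero L)))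
              (UnitaryGroup.archFormOf L 2 (Matrix.diagonal ![(2 : L)⁻¹, -(2 : L)⁻¹])) (UnitaryGroup.archFormOf L 2 (Matrix.of fun i j : Fin 2 => if i.val + j.val + 1 = 2 then (1 : L) else 0))
              (UnitaryGroup.formCongr_map_mixedEmbedding_archFormOf_eq L (UnitaryGroup.formCongr_quasiSplitFrameTwo_diagonal L))).symm
              (UnitaryGroup.archDiagTorus L 2 ![(2 : L)⁻¹, -(2 : L)⁻¹] (twoBlock L e₁ h₁ S (Function.update u w ![embCircle L e₁ h₁ w * Circle.exp ψ, embCircle L e₁ h₁ w * Circle.exp (-ψ)])))),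
            (UnitaryGroup.archPiEquivCM 1 L (Matrix.of fun i j : Fin 1 => if i.val + j.val + 1 = 1 then (1 : L) else 0)).symm fun w' =>
              ⟨UnitaryGroup.circleDiagonal 1 ![embCircle L e₂ h₂ w'], UnitaryGroup.circleDiagonal_mem_archLocal_antidiagOne L w' _⟩)
          (UnitaryGroup.archDiagTorus L 3 α fun v => datum L e₁ e₂ h₁ h₂ S (Function.update u w ![embCircle L e₁ h₁ w * Circle.exp ψ, embCircle L e₁ h₁ w * Circle.exp (-ψ)]) v ∘ ⇑(ρ v)) =
        K ρ * σ ψ := by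
    intro ψ ρ
    have h := hKσ ψ ρ
    simp only [Matrix.cons_val_zero, Matrix.cons_val_one, Matrix.cons_val_two, Matrix.head_cons, Matrix.tail_cons] at h
    rw [hpt]
    simp only [datum, twoBlock_update L e₁ h₁ S u hw]
    exact h
  -- the measure families, weights and limits fed to ★ G3-step
  set μ : ({w : InfinitePlace L // IsComplex w} → Perm (Fin 3)) → ∀ v : {w : InfinitePlace L // IsComplex w}, Measure (archLocal L 3 (Matrix.diagonal α) v) :=
    fun ρ => Function.update (stateMeasure L α νw hνw e₁ e₂ h₁ h₂ hne νH hνH S u ρ) w (wallMeasure L α νw hνw e₁ e₂ h₁ h₂ hne νH hνH w (ρ w)) with hμdef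
  have hμ : ∀ ρ v, IsFiniteMeasureOnCompacts (μ ρ v) ∧ SigmaFinite (μ ρ v) := by
    intro ρ v
    by_cases hv : v = w
    · rw [hv]
      simp only [hμdef, Function.update_self]
      exact isFiniteMeasureOnCompacts_and_sigmaFinite_wallMeasure L α νw hνw e₁ e₂ h₁ h₂ hne νH hνH hα hherm w (ρ w)
    · simp only [hμdef, Function.update_of_ne hv]
      refine isFiniteMeasureOnCompacts_and_sigmaFinite_stateMeasure L α νw hνw e₁ e₂ h₁ h₂ hne νH hνH hα hherm S u ρ v ?_
      by_cases hvS : v ∈ S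
      · exact Or.inl hvS
      · exact Or.inr (hu v hvS hv)
  have hupd : ∀ (ρ : {w : InfinitePlace L // IsComplex w} → Perm (Fin 3)) (m : Measure (archLocal L 3 (Matrix.diagonal α) w)),
      Function.update (μ ρ) w m = Function.update (stateMeasure L α νw hνw e₁ e₂ h₁ h₂ hne νH hνH S u ρ) w m := fun ρ m => by
    simp only [hμdef, Function.update_idem]
  set a : ({w : InfinitePlace L // IsComplex w} → Perm (Fin 3)) → ℂ := fun ρ => (χ.toReal : ℂ) * ((relabelMultiplicity L α : ℕ) : ℂ)⁻¹ * K ρ * ∏ v ∈ S, wallCoef L α v (ρ v) with hadef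
  set ℓ : ({w : InfinitePlace L // IsComplex w} → Perm (Fin 3)) → ℂ := fun ρ => wallCoef L α w (ρ w) *
    ∫ o, Θ ((((archPiEquivCM 3 L (Matrix.diagonal α)).symm o : arch (↥(maximalRealSubfield L)) L (IsCMField.complexConj L) 3 (Matrix.diagonal α)) : GL (Fin 3) (mixedSpace L)) : Matrix (Fin 3) (Fin 3) (mixedSpace L)) ∂(Measure.pi (Function.update (μ ρ) w (wallMeasure L α νw hνw e₁ e₂ h₁ h₂ hne νH hνH w (ρ w)))) with hℓdef
  -- the clause-threaded jump of every noncompact partner at `w`, constant `−1` (the pin, moved to the transported Haar measure by ★ Haar-independence, then ★ G1c)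
  have hcl : ∀ (τ : Perm (Fin 3)), (w.1.embedding (α (τ⁻¹ 0))).re * (w.1.embedding (α (τ⁻¹ 2))).re < 0 →
      ∀ (Θ : Matrix (Fin 3) (Fin 3) (mixedSpace L) → ℂ), ContDiff ℝ (⊤ : ℕ∞) Θ →
        HasCompactSupport (fun g : arch (↥(maximalRealSubfield L)) L (IsCMField.complexConj L) 3 (Matrix.diagonal α) => Θ ((g : GL (Fin 3) (mixedSpace L)) : Matrix (Fin 3) (Fin 3) (mixedSpace L))) →
        ∀ (μall : ∀ v : {w : InfinitePlace L // IsComplex w}, Measure (archLocal L 3 (Matrix.diagonal α) v)) [∀ v, IsFiniteMeasureOnCompacts (μall v)] [∀ v, SigmaFinite (μall v)],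
          (∀ᶠ ψ in 𝓝[>] (0 : ℝ), DifferentiableAt ℝ (fun ψ : ℝ => (2 * Real.sin ψ : ℂ) *
              ∫ o, Θ ((((archPiEquivCM 3 L (Matrix.diagonal α)).symm o : arch (↥(maximalRealSubfield L)) L (IsCMField.complexConj L) 3 (Matrix.diagonal α)) : GL (Fin 3) (mixedSpace L)) : Matrix (Fin 3) (Fin 3) (mixedSpace L))
              ∂(Measure.pi (Function.update μall w ((νw w).map fun y : archLocal L 3 (Matrix.diagonal α) w => y * (⟨circleDiagonal 3 ((fun i => wallPoint L e₁ e₂ h₁ h₂ w i * Circle.exp (![(1 : ℝ), 0, -1] i * ψ)) ∘ ⇑(τ)), circleDiagonal_mem_archLocal_diagonal L 3 α w ((fun i => wallPoint L e₁ e₂ h₁ h₂ w i * Circle.exp (![(1 : ℝ), 0, -1] i * ψ)) ∘ ⇑(τ))⟩ : archLocal L 3 (Matrix.diagonal α) w) * y⁻¹)))) ψ) ∧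
          Tendsto (fun ψ : ℝ => deriv (fun ψ : ℝ => (2 * Real.sin ψ : ℂ) *
              ∫ o, Θ ((((archPiEquivCM 3 L (Matrix.diagonal α)).symm o : arch (↥(maximalRealSubfield L)) L (IsCMField.complexConj L) 3 (Matrix.diagonal α)) : GL (Fin 3) (mixedSpace L)) : Matrix (Fin 3) (Fin 3) (mixedSpace L))
              ∂(Measure.pi (Function.update μall w ((νw w).map fun y : archLocal L 3 (Matrix.diagonal α) w => y * (⟨circleDiagonal 3 ((fun i => wallPoint L e₁ e₂ h₁ h₂ w i * Circle.exp (![(1 : ℝ), 0, -1] i * ψ)) ∘ ⇑(τ)), circleDiagonal_mem_archLocal_diagonal L 3 α w ((fun i => wallPoint L e₁ e₂ h₁ h₂ w i * Circle.exp (![(1 : ℝ), 0, -1] i * ψ)) ∘ ⇑(τ))⟩ : archLocal L 3 (Matrix.diagonal α) w) * y⁻¹)))) ψ) (𝓝[>] 0)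
            (𝓝 ((fun _ : Perm (Fin 3) => (-1 : ℂ)) τ * ∫ o, Θ ((((archPiEquivCM 3 L (Matrix.diagonal α)).symm o : arch (↥(maximalRealSubfield L)) L (IsCMField.complexConj L) 3 (Matrix.diagonal α)) : GL (Fin 3) (mixedSpace L)) : Matrix (Fin 3) (Fin 3) (mixedSpace L))
              ∂(Measure.pi (Function.update μall w (((quotientMeasure _ (νH w (τ)⁻¹) (isClosed_coe_centralizer_singleton _) ((νw w).map (ContinuousMulEquiv.restrictSubgroup (GLn.conjEquiv (Matrix.GeneralLinearGroup.mkOfDetNeZero _ (det_monomial_one_ne_zero 3 (τ)⁻¹)))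
              (archLocal L 3 (Matrix.diagonal (α ∘ ⇑(τ)⁻¹)) w) (archLocal L 3 (Matrix.diagonal α) w)
              (mem_archLocal_comp_perm_iff_conj_mem L 3 α w (τ)⁻¹)).symm)).map
                  (descConj (⟨circleDiagonal 3 (wallPoint L e₁ e₂ h₁ h₂ w), circleDiagonal_mem_archLocal_diagonal L 3 (α ∘ ⇑(τ)⁻¹) w (wallPoint L e₁ e₂ h₁ h₂ w)⟩ : archLocal L 3 (Matrix.diagonal (α ∘ ⇑(τ)⁻¹)) w)
                    (Subgroup.centralizer ({(⟨circleDiagonal 3 (wallPoint L e₁ e₂ h₁ h₂ w), circleDiagonal_mem_archLocal_diagonal L 3 (α ∘ ⇑(τ)⁻¹) w (wallPoint L e₁ e₂ h₁ h₂ w)⟩ :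
                      archLocal L 3 (Matrix.diagonal (α ∘ ⇑(τ)⁻¹)) w)} : Set (archLocal L 3 (Matrix.diagonal (α ∘ ⇑(τ)⁻¹)) w)))
                    (forall_mem_centralizer_circleDiagonal_comm_of_wall L (α ∘ ⇑(τ)⁻¹) w (wallPoint_zero_eq_two L e₁ e₂ h₁ h₂ w) (wallPoint_zero_ne_one L e₁ e₂ h₁ h₂ hne w)
                      (wallPoint_zero_eq_two L e₁ e₂ h₁ h₂ w) (wallPoint_zero_ne_one L e₁ e₂ h₁ h₂ hne w)) id)).map
                  (ContinuousMulEquiv.restrictSubgroup (GLn.conjEquiv (Matrix.GeneralLinearGroup.mkOfDetNeZero _ (det_monomial_one_ne_zero 3 (τ)⁻¹)))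
              (archLocal L 3 (Matrix.diagonal (α ∘ ⇑(τ)⁻¹)) w) (archLocal L 3 (Matrix.diagonal α) w)
              (mem_archLocal_comp_perm_iff_conj_mem L 3 α w (τ)⁻¹))))))) := by
    intro τ hτ
    obtain ⟨ν', hν'h, hν'r, hcl'⟩ := hpin w τ⁻¹ hτ
    have hcl'' := archLimitFormulaNoncompactWall_clause_of_isHaarMeasure L (α ∘ ⇑τ⁻¹) w ν'
      ((νw w).map (ContinuousMulEquiv.restrictSubgroup (GLn.conjEquiv (Matrix.GeneralLinearGroup.mkOfDetNeZero _ (det_monomial_one_ne_zero 3 τ⁻¹)))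
        (archLocal L 3 (Matrix.diagonal (α ∘ ⇑τ⁻¹)) w) (archLocal L 3 (Matrix.diagonal α) w)
        (mem_archLocal_comp_perm_iff_conj_mem L 3 α w τ⁻¹)).symm)
      (wallPoint L e₁ e₂ h₁ h₂ w) h02 h01 (νH w τ⁻¹) (-1) hcl'
    exact fun Θ' hΘ' hΘc' μall _ _ =>
      K2E4ArchPartnerWallJumpOfClause.tendsto_deriv_wallJump_partner_noncompact_orbitMeasure_of_clause L α w hα hherm (νw w) τ
        (wallPoint L e₁ e₂ h₁ h₂ w) h02 h01 (νH w τ⁻¹) (-1) hcl'' Θ' hΘ' hΘc' μall (wallPoint L e₁ e₂ h₁ h₂ w) h02 h01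
  -- ★ G3-step
  have hstep := K2E4ArchGStateStep.tendsto_deriv_gState_step L α w hα hherm (νw w) (wallPoint L e₁ e₂ h₁ h₂ w) h02 h01 (νH w) (fun _ => (-1 : ℂ)) hcl
    Θ hΘ hΘc μ hμ a σ hσ heven ℓ ?_ ?_
    (fun ψ => gState L α νw hνw e₁ e₂ h₁ h₂ hne νH hνH T' χ Θ S (Function.update u w ![embCircle L e₁ h₁ w * Circle.exp ψ, embCircle L e₁ h₁ w * Circle.exp (-ψ)])) ?_
  rotate_left
  · -- `hℓc`: compact partner
    intro ρ hcw
    simp only [hℓdef, wallCoef, if_pos hcw, wallMeasure_of_pos L α νw hνw e₁ e₂ h₁ h₂ hne νH hνH w (ρ w) hcw]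
  · -- `hℓn`: noncompact partner
    intro ρ hlt
    have hn : ¬ 0 < (w.1.embedding (α ((ρ w)⁻¹ 0))).re * (w.1.embedding (α ((ρ w)⁻¹ 2))).re := not_lt.2 hlt.le
    simp only [hℓdef, wallCoef, if_neg hn, wallMeasure_of_not_pos L α νw hνw e₁ e₂ h₁ h₂ hne νH hνH w (ρ w) hn]
    rfl
  · -- `hB`: the state along the curve, summand by summand
    intro ψ
    unfold gState
    refine Finset.sum_congr rfl fun ρ _ => ?_
    rw [hΔ ψ ρ, stateMeasure_update_curve L α νw hνw e₁ e₂ h₁ h₂ hne νH hνH S u hw ψ ρ, ← hupd ρ]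
    simp only [hadef]
    ring
  -- the end state of the step: `Σ_ρ a_ρ σ(0) ℓ_ρ = B(S ∪ {w}, u)`
  have hend : gState L α νw hνw e₁ e₂ h₁ h₂ hne νH hνH T' χ Θ (insert w S) u = ∑ ρ : {w : InfinitePlace L // IsComplex w} → Perm (Fin 3), a ρ * σ 0 * ℓ ρ := by
    unfold gState
    refine Finset.sum_congr rfl fun ρ _ => ?_
    have h0 := hΔ 0 ρ
    simp only [Circle.exp_zero, neg_zero, mul_one] at h0
    have hdat : datum L e₁ e₂ h₁ h₂ (insert w S) u = datum L e₁ e₂ h₁ h₂ S (Function.update u w ![embCircle L e₁ h₁ w, embCircle L e₁ h₁ w]) := by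
      funext v
      simp only [datum, twoBlock_insert, twoBlock_update L e₁ h₁ S u hw]
    have htwo : twoBlock L e₁ h₁ (insert w S) u = twoBlock L e₁ h₁ S (Function.update u w ![embCircle L e₁ h₁ w, embCircle L e₁ h₁ w]) := by
      rw [twoBlock_insert, twoBlock_update L e₁ h₁ S u hw]
    rw [hdat, htwo, h0, stateMeasure_insert L α νw hνw e₁ e₂ h₁ h₂ hne νH hνH S u hw ρ, ← hupd ρ, Finset.prod_insert hw]
    simp only [hadef, hℓdef]
    ring
  rw [hend, K2E4ArchGStateStepCalculus.two_sin_smul_eq_ofReal_mul]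
  exact hstep


end Summit.HodgeConjecture.HodgeConjecture.Cruxes.H413.K2E4ArchGPrimeStep

end
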